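import Mathlib.Algebra.Order.BigOperators.Group.Finset
import Mathlib.Tactic
import HarnessLib
import HarnessLib.Audit.Tags

/-!
# Purely inseparable four-folds — the C∞ GAME, WINDOW form: a letter change is followed by at most
# seven legal letters (cell `res-dim4-pi`, K2(p) lane, slice B brick K24b-α, local form for design (iii))

[OURS · counted 0 · cell `res-dim4-pi` · lane holder res-dim4-p-12 g3's F2 design ruling (iii) «LOCAL WINDOW,
re-framed at the letter change» (bus 2026-08-29 02:51Z); game/tables res-dim4-idea-4 g3/g4; proof res-dim4-p-9
g3; seat res-dim4-p-9 g3.]  Nothing here proves K2(p)/K2(5), `NoIsolatedTrap p p` or resolution of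
singularities in dimension ≥ 4 / characteristic `p`.  This is the FINITE-HORIZON cut of
`…ResConeCInfGameExact` (p690805): the same proof read off a bounded window, so that the frame (F1–F3) owes
its transport / legality / flag readings at NINE consecutive steps of ONE jet frame only.

Monomials `(c, a, b, e)` = `x_λ^a x_μ^b ū^e` in the family of constant `c ≤ 3` (`B₀, B₁, S₁, S₂`); word
`x : ℕ → Bool` (`true = λ`) with the LETTER CHANGE `x 0 = λ`, `x 1 = μ` (time re-indexed at the change);
λ-STEP `(c, a, b, e) ↦ (c, a + b + e − c, b, e)`, μ-STEP the mirror; DEAD `c ≤ a + e ∧ c ≤ b + e`;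
λ-WITNESS `b + e + 1 ≤ c`, μ-WITNESS `a + e + 1 ≤ c`; LEGAL(λ) `2c ≤ a + 2b + 2e`, LEGAL(μ) `2c ≤ 2a + b + 2e`.
WINDOW (binders over components, explicit numerals): legality at steps `0…8`, forward law for live images at
steps `0…7`, backward law for live monomials at steps `0…5`, both flags at the states `2…6`, `c ≤ 3`.
**`Window.no_play_after_change`**: these cannot all hold — «λμ + 7 legal letters with both flags at the five
states after the change» is impossible for ANY supports (the model-checked optimum is λμ + 5; the two extra
letters buy a certificate-free proof).  Far monomials are never read: every monomial the proof touches is a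
witness at a state `≥ 1` or its one-step parent/child.

Proof = the p690805 mechanism on a clock.  With `c ≤ 3` a DOUBLE witness (`a + e < c ∧ b + e < c`) present at
`t` makes steps `t` and `t + 1` not both legal (`double_blocks`), so inside the window nobody is double; hence
at a λ-step every λ-witness has `2c ≤ a + b + 2e` (`lambda_step_bound`), a λ-witness at `t + 1` is the image of
a λ-witness with `c ≤ a₀ + e` (`lambda_witness_pre`), after the μ-step every λ-witness obeys
`#λ since + a + 2e + 1 ≤ 2c` (`after_mu_count`), so **at most 2 letters λ among steps 2…6**
(`few_lambda_after_mu`); by the mirror (`Mirror.*`) at most 2 letters μ there — but there are 5 steps.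

bears_on: LADDER-RESOLUTION:D157-DOOR2 (res-dim4-pi · K2(p) · slice B · K24b-α window form).  Supports
stmt-ResolutionOfSingularities-16155 (helper).
-/

set_option linter.dupNamespace false -- mandated namespace of this single-conjunct summit

namespace Summit.ResolutionOfSingularities.ResolutionOfSingularities.Theorems.PIDim4

namespace ResCone

namespace CInfGame

namespace Window

open Finset

variable {x : ℕ → Bool} {P : ℕ → ℕ × ℕ × ℕ × ℕ → Prop}

/-- **A double witness blocks within one step** (`c ≤ 3`): if `(c, a, b, e)` with `a + e < c`, `b + e < c` is
present at `t ≤ 7`, steps `t` and `t + 1` are not both legal. [OURS] [folklore] -/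
theorem double_blocks
    (hC : ∀ t c a b e, P t (c, a, b, e) → c ≤ 3)
    (hfwdL : ∀ t c a b e, t + 1 ≤ 8 → P t (c, a, b, e) → x t = true →
      ¬ (c ≤ a + b + e - c + e ∧ c ≤ b + e) → P (t + 1) (c, a + b + e - c, b, e))
    (hfwdM : ∀ t c a b e, t + 1 ≤ 8 → P t (c, a, b, e) → x t = false →
      ¬ (c ≤ a + e ∧ c ≤ a + b + e - c + e) → P (t + 1) (c, a, a + b + e - c, e))
    (hlegL : ∀ t c a b e, t ≤ 8 → P t (c, a, b, e) → x t = true → 2 * c ≤ a + 2 * b + 2 * e)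
    (hlegM : ∀ t c a b e, t ≤ 8 → P t (c, a, b, e) → x t = false → 2 * c ≤ 2 * a + b + 2 * e)
    {t c a b e : ℕ} (ht : t + 1 ≤ 8) (hm : P t (c, a, b, e)) (ha : a + e + 1 ≤ c) (hb : b + e + 1 ≤ c) :
    False := by
  have hc := hC t c a b e hm
  cases hx : x t with
  | true =>
    have l := hlegL t c a b e (by omega) hm hx
    have hP := hfwdL t c a b e ht hm hx (by omega)
    cases hx' : x (t + 1) with
    | true => have l' := hlegL (t + 1) _ _ _ _ ht hP hx'; omega
    | false => have l' := hlegM (t + 1) _ _ _ _ ht hP hx'; omega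
  | false =>
    have l := hlegM t c a b e (by omega) hm hx
    have hP := hfwdM t c a b e ht hm hx (by omega)
    cases hx' : x (t + 1) with
    | true => have l' := hlegL (t + 1) _ _ _ _ ht hP hx'; omega
    | false => have l' := hlegM (t + 1) _ _ _ _ ht hP hx'; omega

/-- A λ-witness present at `t ≤ 7` lies in `c ≤ a + e`. [OURS] [folklore] -/
theorem lambda_witness_L
    (hC : ∀ t c a b e, P t (c, a, b, e) → c ≤ 3)
    (hfwdL : ∀ t c a b e, t + 1 ≤ 8 → P t (c, a, b, e) → x t = true →
      ¬ (c ≤ a + b + e - c + e ∧ c ≤ b + e) → P (t + 1) (c, a + b + e - c, b, e))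
    (hfwdM : ∀ t c a b e, t + 1 ≤ 8 → P t (c, a, b, e) → x t = false →
      ¬ (c ≤ a + e ∧ c ≤ a + b + e - c + e) → P (t + 1) (c, a, a + b + e - c, e))
    (hlegL : ∀ t c a b e, t ≤ 8 → P t (c, a, b, e) → x t = true → 2 * c ≤ a + 2 * b + 2 * e)
    (hlegM : ∀ t c a b e, t ≤ 8 → P t (c, a, b, e) → x t = false → 2 * c ≤ 2 * a + b + 2 * e)
    {t c a b e : ℕ} (ht : t + 1 ≤ 8) (hm : P t (c, a, b, e)) (hb : b + e + 1 ≤ c) : c ≤ a + e := by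
  by_contra h
  exact double_blocks hC hfwdL hfwdM hlegL hlegM ht hm (by omega) hb

/-- **λ-step bound**: at a λ-step at `t ≤ 6` every present λ-witness has `2c ≤ a + b + 2e`. [OURS] [folklore] -/
theorem lambda_step_bound
    (hC : ∀ t c a b e, P t (c, a, b, e) → c ≤ 3)
    (hfwdL : ∀ t c a b e, t + 1 ≤ 8 → P t (c, a, b, e) → x t = true →
      ¬ (c ≤ a + b + e - c + e ∧ c ≤ b + e) → P (t + 1) (c, a + b + e - c, b, e))
    (hfwdM : ∀ t c a b e, t + 1 ≤ 8 → P t (c, a, b, e) → x t = false →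
      ¬ (c ≤ a + e ∧ c ≤ a + b + e - c + e) → P (t + 1) (c, a, a + b + e - c, e))
    (hlegL : ∀ t c a b e, t ≤ 8 → P t (c, a, b, e) → x t = true → 2 * c ≤ a + 2 * b + 2 * e)
    (hlegM : ∀ t c a b e, t ≤ 8 → P t (c, a, b, e) → x t = false → 2 * c ≤ 2 * a + b + 2 * e)
    {t c a b e : ℕ} (ht : t + 2 ≤ 8) (hx : x t = true) (hm : P t (c, a, b, e)) (hb : b + e + 1 ≤ c) :
    2 * c ≤ a + b + 2 * e := by
  have ha := lambda_witness_L hC hfwdL hfwdM hlegL hlegM (by omega) hm hb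
  have hP := hfwdL t c a b e (by omega) hm hx (by omega)
  have := lambda_witness_L hC hfwdL hfwdM hlegL hlegM ht hP hb
  omega

/-- **Predecessor of a λ-witness** (child at `t + 1`, `t ≤ 5`): the image of a present λ-witness with
`c ≤ a₀ + e`. [OURS] [folklore] -/
theorem lambda_witness_pre
    (hC : ∀ t c a b e, P t (c, a, b, e) → c ≤ 3)
    (hfwdL : ∀ t c a b e, t + 1 ≤ 8 → P t (c, a, b, e) → x t = true →
      ¬ (c ≤ a + b + e - c + e ∧ c ≤ b + e) → P (t + 1) (c, a + b + e - c, b, e))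
    (hfwdM : ∀ t c a b e, t + 1 ≤ 8 → P t (c, a, b, e) → x t = false →
      ¬ (c ≤ a + e ∧ c ≤ a + b + e - c + e) → P (t + 1) (c, a, a + b + e - c, e))
    (hlegL : ∀ t c a b e, t ≤ 8 → P t (c, a, b, e) → x t = true → 2 * c ≤ a + 2 * b + 2 * e)
    (hlegM : ∀ t c a b e, t ≤ 8 → P t (c, a, b, e) → x t = false → 2 * c ≤ 2 * a + b + 2 * e)
    (hevol : ∀ t c a b e, t + 3 ≤ 8 → P (t + 1) (c, a, b, e) → (c ≤ a + e ∧ c ≤ b + e) ∨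
      ∃ a₀ b₀, P t (c, a₀, b₀, e) ∧ ((x t = true ∧ a = a₀ + b₀ + e - c ∧ b = b₀) ∨
        (x t = false ∧ a = a₀ ∧ b = a₀ + b₀ + e - c)))
    {t c a b e : ℕ} (ht : t + 3 ≤ 8) (hm : P (t + 1) (c, a, b, e)) (hb : b + e + 1 ≤ c) :
    ∃ a₀ b₀, P t (c, a₀, b₀, e) ∧ b₀ + e + 1 ≤ c ∧ c ≤ a₀ + e ∧
      ((x t = true ∧ a = a₀ + b₀ + e - c ∧ b = b₀) ∨ (x t = false ∧ a = a₀ ∧ b = a₀ + b₀ + e - c)) := by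
  rcases hevol t c a b e ht hm with hdead | ⟨a₀, b₀, hm₀, hcase⟩
  · exfalso; omega
  · rcases hcase with ⟨hx, ha, hb0⟩ | ⟨hx, ha, hb0⟩
    · have hb₀ : b₀ + e + 1 ≤ c := by omega
      exact ⟨a₀, b₀, hm₀, hb₀, lambda_witness_L hC hfwdL hfwdM hlegL hlegM (by omega) hm₀ hb₀, Or.inl ⟨hx, ha, hb0⟩⟩
    · have haL : c ≤ a₀ + e := by
        by_contra h
        exact double_blocks hC hfwdL hfwdM hlegL hlegM (t := t + 1) (by omega) hm (by omega) hb
      have hb₀ : b₀ + e + 1 ≤ c := by omega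
      exact ⟨a₀, b₀, hm₀, hb₀, haL, Or.inr ⟨hx, ha, hb0⟩⟩

/-- **After a μ-step at `s₁` every λ-witness has `a + 2e + 1 ≤ 2c`** (states `s₁ + 1 + k ≤ 6`).
[OURS] [folklore] -/
theorem after_mu_bound
    (hC : ∀ t c a b e, P t (c, a, b, e) → c ≤ 3)
    (hfwdL : ∀ t c a b e, t + 1 ≤ 8 → P t (c, a, b, e) → x t = true →
      ¬ (c ≤ a + b + e - c + e ∧ c ≤ b + e) → P (t + 1) (c, a + b + e - c, b, e))
    (hfwdM : ∀ t c a b e, t + 1 ≤ 8 → P t (c, a, b, e) → x t = false →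
      ¬ (c ≤ a + e ∧ c ≤ a + b + e - c + e) → P (t + 1) (c, a, a + b + e - c, e))
    (hlegL : ∀ t c a b e, t ≤ 8 → P t (c, a, b, e) → x t = true → 2 * c ≤ a + 2 * b + 2 * e)
    (hlegM : ∀ t c a b e, t ≤ 8 → P t (c, a, b, e) → x t = false → 2 * c ≤ 2 * a + b + 2 * e)
    (hevol : ∀ t c a b e, t + 3 ≤ 8 → P (t + 1) (c, a, b, e) → (c ≤ a + e ∧ c ≤ b + e) ∨
      ∃ a₀ b₀, P t (c, a₀, b₀, e) ∧ ((x t = true ∧ a = a₀ + b₀ + e - c ∧ b = b₀) ∨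
        (x t = false ∧ a = a₀ ∧ b = a₀ + b₀ + e - c)))
    {s₁ : ℕ} (hs : x s₁ = false) (k : ℕ) (hk : s₁ + k + 3 ≤ 8) :
    ∀ c a b e, P (s₁ + 1 + k) (c, a, b, e) → b + e + 1 ≤ c → a + 2 * e + 1 ≤ 2 * c := by
  induction k with
  | zero =>
    intro c a b e hm hb
    obtain ⟨a₀, b₀, _, hb₀, ha₀, hcase⟩ := lambda_witness_pre hC hfwdL hfwdM hlegL hlegM hevol (by omega) hm hb
    rcases hcase with ⟨hx, _, _⟩ | ⟨_, ha, hb'⟩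
    · rw [hs] at hx; exact absurd hx (by decide)
    · omega
  | succ k ih =>
    intro c a b e hm hb
    rw [show s₁ + 1 + (k + 1) = s₁ + 1 + k + 1 from rfl] at hm
    obtain ⟨a₀, b₀, hm₀, hb₀, ha₀, hcase⟩ := lambda_witness_pre hC hfwdL hfwdM hlegL hlegM hevol (by omega) hm hb
    have := ih (by omega) c a₀ b₀ e hm₀ hb₀
    rcases hcase with ⟨_, ha, hb'⟩ | ⟨_, ha, hb'⟩ <;> omega

/-- **Counting form**: from a time `t` after the μ-step, a λ-witness present at `t + k` (`t + k + 2 ≤ 8`)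
satisfies `#{i < k : x (t + i) = λ} + a + 2e + 1 ≤ 2c`. [OURS] [folklore] -/
theorem after_mu_count
    (hC : ∀ t c a b e, P t (c, a, b, e) → c ≤ 3)
    (hfwdL : ∀ t c a b e, t + 1 ≤ 8 → P t (c, a, b, e) → x t = true →
      ¬ (c ≤ a + b + e - c + e ∧ c ≤ b + e) → P (t + 1) (c, a + b + e - c, b, e))
    (hfwdM : ∀ t c a b e, t + 1 ≤ 8 → P t (c, a, b, e) → x t = false →
      ¬ (c ≤ a + e ∧ c ≤ a + b + e - c + e) → P (t + 1) (c, a, a + b + e - c, e))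
    (hlegL : ∀ t c a b e, t ≤ 8 → P t (c, a, b, e) → x t = true → 2 * c ≤ a + 2 * b + 2 * e)
    (hlegM : ∀ t c a b e, t ≤ 8 → P t (c, a, b, e) → x t = false → 2 * c ≤ 2 * a + b + 2 * e)
    (hevol : ∀ t c a b e, t + 3 ≤ 8 → P (t + 1) (c, a, b, e) → (c ≤ a + e ∧ c ≤ b + e) ∨
      ∃ a₀ b₀, P t (c, a₀, b₀, e) ∧ ((x t = true ∧ a = a₀ + b₀ + e - c ∧ b = b₀) ∨
        (x t = false ∧ a = a₀ ∧ b = a₀ + b₀ + e - c)))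
    {s₁ t : ℕ} (hs : x s₁ = false) (hst : s₁ + 1 ≤ t) (k : ℕ) (hk : t + k + 2 ≤ 8) :
    ∀ c a b e, P (t + k) (c, a, b, e) → b + e + 1 ≤ c →
      (∑ i ∈ range k, (x (t + i)).toNat) + a + 2 * e + 1 ≤ 2 * c := by
  induction k with
  | zero =>
    intro c a b e hm hb
    rw [show t + 0 = s₁ + 1 + (t - (s₁ + 1)) from by omega] at hm
    have := after_mu_bound hC hfwdL hfwdM hlegL hlegM hevol hs _ (by omega) c a b e hm hb
    simpa using this
  | succ k ih =>
    intro c a b e hm hb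
    rw [show t + (k + 1) = t + k + 1 from rfl] at hm
    obtain ⟨a₀, b₀, hm₀, hb₀, ha₀, hcase⟩ := lambda_witness_pre hC hfwdL hfwdM hlegL hlegM hevol (by omega) hm hb
    have := ih (by omega) c a₀ b₀ e hm₀ hb₀
    rw [sum_range_succ]
    rcases hcase with ⟨hx, ha, hb'⟩ | ⟨hx, ha, hb'⟩
    · rw [hx, Bool.toNat_true]; omega
    · rw [hx, Bool.toNat_false]; omega

/-- **After a μ-step at most 2 further letters λ inside the window**: `#{i < k : x (t + i) = λ} + 1 ≤ 3`
for `t` after the μ-step, `2 ≤ t`, `t + k + 1 ≤ 8`. [OURS] [folklore] -/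
theorem few_lambda_after_mu
    (hC : ∀ t c a b e, P t (c, a, b, e) → c ≤ 3)
    (hfwdL : ∀ t c a b e, t + 1 ≤ 8 → P t (c, a, b, e) → x t = true →
      ¬ (c ≤ a + b + e - c + e ∧ c ≤ b + e) → P (t + 1) (c, a + b + e - c, b, e))
    (hfwdM : ∀ t c a b e, t + 1 ≤ 8 → P t (c, a, b, e) → x t = false →
      ¬ (c ≤ a + e ∧ c ≤ a + b + e - c + e) → P (t + 1) (c, a, a + b + e - c, e))
    (hlegL : ∀ t c a b e, t ≤ 8 → P t (c, a, b, e) → x t = true → 2 * c ≤ a + 2 * b + 2 * e)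
    (hlegM : ∀ t c a b e, t ≤ 8 → P t (c, a, b, e) → x t = false → 2 * c ≤ 2 * a + b + 2 * e)
    (hevol : ∀ t c a b e, t + 3 ≤ 8 → P (t + 1) (c, a, b, e) → (c ≤ a + e ∧ c ≤ b + e) ∨
      ∃ a₀ b₀, P t (c, a₀, b₀, e) ∧ ((x t = true ∧ a = a₀ + b₀ + e - c ∧ b = b₀) ∨
        (x t = false ∧ a = a₀ ∧ b = a₀ + b₀ + e - c)))
    (hflagL : ∀ t, 2 ≤ t → t ≤ 6 → ∃ c a b e, P t (c, a, b, e) ∧ b + e + 1 ≤ c)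
    {s₁ t : ℕ} (hs : x s₁ = false) (hst : s₁ + 1 ≤ t) (h2 : 2 ≤ t) (k : ℕ) (hk : t + k + 1 ≤ 8) :
    (∑ i ∈ range k, (x (t + i)).toNat) + 1 ≤ 3 := by
  induction k with
  | zero => simp
  | succ k ih =>
    rw [sum_range_succ]
    cases hx : x (t + k) with
    | false => rw [Bool.toNat_false]; have := ih (by omega); omega
    | true =>
      rw [Bool.toNat_true]
      obtain ⟨c, a, b, e, hm, hb⟩ := hflagL (t + k) (by omega) (by omega)
      have h1 := after_mu_count hC hfwdL hfwdM hlegL hlegM hevol hs hst k (by omega) c a b e hm hb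
      have h2 := lambda_step_bound hC hfwdL hfwdM hlegL hlegM (by omega) hx hm hb
      have h3 := hC _ c a b e hm
      omega

/-! The mirror `a ↔ b`, `λ ↔ μ`: hypotheses of the swapped play along `!x`, in unfolded form. -/

namespace Mirror

/-- Mirror of `hC`. [folklore] -/
theorem hC (hC : ∀ t c a b e, P t (c, a, b, e) → c ≤ 3) : ∀ t c a b e, P t (c, b, a, e) → c ≤ 3 :=
  fun t c a b e hm => hC t c b a e hm

/-- Mirror forward law (λ' from μ). [folklore] -/
theorem hfwdL
    (hfwdM : ∀ t c a b e, t + 1 ≤ 8 → P t (c, a, b, e) → x t = false →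
      ¬ (c ≤ a + e ∧ c ≤ a + b + e - c + e) → P (t + 1) (c, a, a + b + e - c, e)) :
    ∀ t c a b e, t + 1 ≤ 8 → P t (c, b, a, e) → (!x t) = true →
      ¬ (c ≤ a + b + e - c + e ∧ c ≤ b + e) → P (t + 1) (c, b, a + b + e - c, e) := by
  intro t c a b e ht hm hx hnd
  have hx' : x t = false := by simpa using hx
  have h := hfwdM t c b a e ht hm hx' (by rw [Nat.add_comm b a]; omega)
  rw [Nat.add_comm b a] at h
  exact h

/-- Mirror forward law (μ' from λ). [folklore] -/
theorem hfwdM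
    (hfwdL : ∀ t c a b e, t + 1 ≤ 8 → P t (c, a, b, e) → x t = true →
      ¬ (c ≤ a + b + e - c + e ∧ c ≤ b + e) → P (t + 1) (c, a + b + e - c, b, e)) :
    ∀ t c a b e, t + 1 ≤ 8 → P t (c, b, a, e) → (!x t) = false →
      ¬ (c ≤ a + e ∧ c ≤ a + b + e - c + e) → P (t + 1) (c, a + b + e - c, a, e) := by
  intro t c a b e ht hm hx hnd
  have hx' : x t = true := by simpa using hx
  have h := hfwdL t c b a e ht hm hx' (by rw [Nat.add_comm b a]; omega)
  rw [Nat.add_comm b a] at h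
  exact h

/-- Mirror backward law. [folklore] -/
theorem hevol
    (hevol : ∀ t c a b e, t + 3 ≤ 8 → P (t + 1) (c, a, b, e) → (c ≤ a + e ∧ c ≤ b + e) ∨
      ∃ a₀ b₀, P t (c, a₀, b₀, e) ∧ ((x t = true ∧ a = a₀ + b₀ + e - c ∧ b = b₀) ∨
        (x t = false ∧ a = a₀ ∧ b = a₀ + b₀ + e - c))) :
    ∀ t c a b e, t + 3 ≤ 8 → P (t + 1) (c, b, a, e) → (c ≤ a + e ∧ c ≤ b + e) ∨
      ∃ a₀ b₀, P t (c, b₀, a₀, e) ∧ (((!x t) = true ∧ a = a₀ + b₀ + e - c ∧ b = b₀) ∨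
        ((!x t) = false ∧ a = a₀ ∧ b = a₀ + b₀ + e - c)) := by
  intro t c a b e ht hm
  rcases hevol t c b a e ht hm with hdead | ⟨a₁, b₁, hm₁, hcase⟩
  · exact Or.inl ⟨hdead.2, hdead.1⟩
  · refine Or.inr ⟨b₁, a₁, hm₁, ?_⟩
    rcases hcase with ⟨hx, h1, h2⟩ | ⟨hx, h1, h2⟩
    · right; refine ⟨by simp [hx], h2, ?_⟩; rw [h1, Nat.add_comm a₁ b₁]
    · left; refine ⟨by simp [hx], ?_, h1⟩; rw [h2, Nat.add_comm a₁ b₁]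

/-- Mirror legality (λ' from μ). [folklore] -/
theorem hlegL (hlegM : ∀ t c a b e, t ≤ 8 → P t (c, a, b, e) → x t = false → 2 * c ≤ 2 * a + b + 2 * e) :
    ∀ t c a b e, t ≤ 8 → P t (c, b, a, e) → (!x t) = true → 2 * c ≤ a + 2 * b + 2 * e := by
  intro t c a b e ht hm hx
  have hx' : x t = false := by simpa using hx
  have := hlegM t c b a e ht hm hx'; omega

/-- Mirror legality (μ' from λ). [folklore] -/
theorem hlegM (hlegL : ∀ t c a b e, t ≤ 8 → P t (c, a, b, e) → x t = true → 2 * c ≤ a + 2 * b + 2 * e) :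
    ∀ t c a b e, t ≤ 8 → P t (c, b, a, e) → (!x t) = false → 2 * c ≤ 2 * a + b + 2 * e := by
  intro t c a b e ht hm hx
  have hx' : x t = true := by simpa using hx
  have := hlegL t c b a e ht hm hx'; omega

/-- Mirror flag (λ' from μ). [folklore] -/
theorem hflagL (hflagM : ∀ t, 2 ≤ t → t ≤ 6 → ∃ c a b e, P t (c, a, b, e) ∧ a + e + 1 ≤ c) :
    ∀ t, 2 ≤ t → t ≤ 6 → ∃ c a b e, P t (c, b, a, e) ∧ b + e + 1 ≤ c := by
  intro t h2 h6
  obtain ⟨c, a, b, e, hm, ha⟩ := hflagM t h2 h6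
  exact ⟨c, b, a, e, hm, ha⟩

end Mirror

/-- **After a λ-step at most 2 further letters μ inside the window** (mirror). [OURS] [folklore] -/
theorem few_mu_after_lambda
    (hC : ∀ t c a b e, P t (c, a, b, e) → c ≤ 3)
    (hfwdL : ∀ t c a b e, t + 1 ≤ 8 → P t (c, a, b, e) → x t = true →
      ¬ (c ≤ a + b + e - c + e ∧ c ≤ b + e) → P (t + 1) (c, a + b + e - c, b, e))
    (hfwdM : ∀ t c a b e, t + 1 ≤ 8 → P t (c, a, b, e) → x t = false →
      ¬ (c ≤ a + e ∧ c ≤ a + b + e - c + e) → P (t + 1) (c, a, a + b + e - c, e))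
    (hlegL : ∀ t c a b e, t ≤ 8 → P t (c, a, b, e) → x t = true → 2 * c ≤ a + 2 * b + 2 * e)
    (hlegM : ∀ t c a b e, t ≤ 8 → P t (c, a, b, e) → x t = false → 2 * c ≤ 2 * a + b + 2 * e)
    (hevol : ∀ t c a b e, t + 3 ≤ 8 → P (t + 1) (c, a, b, e) → (c ≤ a + e ∧ c ≤ b + e) ∨
      ∃ a₀ b₀, P t (c, a₀, b₀, e) ∧ ((x t = true ∧ a = a₀ + b₀ + e - c ∧ b = b₀) ∨
        (x t = false ∧ a = a₀ ∧ b = a₀ + b₀ + e - c)))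
    (hflagM : ∀ t, 2 ≤ t → t ≤ 6 → ∃ c a b e, P t (c, a, b, e) ∧ a + e + 1 ≤ c)
    {s₁ t : ℕ} (hs : x s₁ = true) (hst : s₁ + 1 ≤ t) (h2 : 2 ≤ t) (k : ℕ) (hk : t + k + 1 ≤ 8) :
    (∑ i ∈ range k, (!x (t + i)).toNat) + 1 ≤ 3 :=
  few_lambda_after_mu (x := fun s => !x s) (P := fun t m => P t (m.1, m.2.2.1, m.2.1, m.2.2.2))
    (Mirror.hC hC) (Mirror.hfwdL hfwdM) (Mirror.hfwdM hfwdL) (Mirror.hlegL hlegM) (Mirror.hlegM hlegL)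
    (Mirror.hevol hevol) (Mirror.hflagL hflagM) (by simp [hs]) hst h2 k hk

/-- **THE WINDOW THEOREM: a letter change `λμ` is followed by at most seven legal doubly-flagged letters.**
Time re-indexed at the change (`x 0 = λ`, `x 1 = μ`); for ANY supports: LEGAL at steps `0…8`, the FORWARD
law for live images at steps `0…7`, the BACKWARD law for live monomials at steps `0…5`, both isolation FLAGS
at states `2…6`, family constants `≤ 3` — contradiction.  (Among steps `2…6` at most 2 are λ and at most 2
are μ.) [OURS] [folklore] -/
theorem no_play_after_change (x : ℕ → Bool) (P : ℕ → ℕ × ℕ × ℕ × ℕ → Prop)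
    (hx0 : x 0 = true) (hx1 : x 1 = false)
    (hC : ∀ t c a b e, P t (c, a, b, e) → c ≤ 3)
    (hfwdL : ∀ t c a b e, t + 1 ≤ 8 → P t (c, a, b, e) → x t = true →
      ¬ (c ≤ a + b + e - c + e ∧ c ≤ b + e) → P (t + 1) (c, a + b + e - c, b, e))
    (hfwdM : ∀ t c a b e, t + 1 ≤ 8 → P t (c, a, b, e) → x t = false →
      ¬ (c ≤ a + e ∧ c ≤ a + b + e - c + e) → P (t + 1) (c, a, a + b + e - c, e))
    (hlegL : ∀ t c a b e, t ≤ 8 → P t (c, a, b, e) → x t = true → 2 * c ≤ a + 2 * b + 2 * e)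
    (hlegM : ∀ t c a b e, t ≤ 8 → P t (c, a, b, e) → x t = false → 2 * c ≤ 2 * a + b + 2 * e)
    (hevol : ∀ t c a b e, t + 3 ≤ 8 → P (t + 1) (c, a, b, e) → (c ≤ a + e ∧ c ≤ b + e) ∨
      ∃ a₀ b₀, P t (c, a₀, b₀, e) ∧ ((x t = true ∧ a = a₀ + b₀ + e - c ∧ b = b₀) ∨
        (x t = false ∧ a = a₀ ∧ b = a₀ + b₀ + e - c)))
    (hflagL : ∀ t, 2 ≤ t → t ≤ 6 → ∃ c a b e, P t (c, a, b, e) ∧ b + e + 1 ≤ c)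
    (hflagM : ∀ t, 2 ≤ t → t ≤ 6 → ∃ c a b e, P t (c, a, b, e) ∧ a + e + 1 ≤ c) : False := by
  have h1 := few_lambda_after_mu hC hfwdL hfwdM hlegL hlegM hevol hflagL hx1 (t := 2) (by omega) le_rfl 5 (by omega)
  have h2 := few_mu_after_lambda hC hfwdL hfwdM hlegL hlegM hevol hflagM hx0 (t := 2) (by omega) le_rfl 5 (by omega)
  have hsum : ∀ k, (∑ i ∈ range k, (x (2 + i)).toNat) + (∑ i ∈ range k, (!x (2 + i)).toNat) = k := by
    intro k
    induction k with
    | zero => simp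
    | succ k ih =>
      rw [sum_range_succ, sum_range_succ]
      cases x (2 + k) <;> simp <;> omega
  have := hsum 5
  omega

end Window

end CInfGame

end ResCone

end Summit.ResolutionOfSingularities.ResolutionOfSingularities.Theorems.PIDim4
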